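import Literature.Probability.Percolation.SepArmsGlue
import HarnessLib

/-!
# Non-vacuity of the well-separated `k`-arm events `sepArms κ` (`k ≤ 6`, any colours)

Topic: Probability / Percolation; family `crit-perc` (critical site percolation `P = P_{1/2}` on the
triangular lattice `𝕋`). Sanity companion of `SepArmsGlue.lean` / `SepArmsQuasiMult.lean`, which
reduce the clause of the named fact `Literature.Probability.Percolation.Nolin2008_prop17_quasiMult`
(P. Nolin, *Near-critical percolation in two dimensions*, EJP 13 (2008), Prop. 17 [arXiv 0711.4948:
Prop. 16]) for `k ≤ 6` arms of colours `κ` to the separation hypothesis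
`c · π_κ(n, N) ≤ P_{1/2}(sepArms κ n N)` (Nolin's Thm. 11 [arXiv Thm. 10] for the pattern `(k, κ)`).
Here the NECESSARY condition `P_{1/2}(sepArms κ n N) > 0` of that hypothesis is checked
(`π_κ(n, N) > 0` at bounded ratio by `exists_le_polyArmProb_of_le_mul_any`), exactly as
`triSitePercolation_sepFourArm_pos` (`ArmSeparationFourArmProofs.lean`) does for `sepFourArm`:

* `coneConfig κ` — the configuration open exactly on the open cones `ρ^j(triCone)`, `κ j = true`;
* `triCone_le_readFrame_coneConfig`, `coneConfig_mem_sepArms` — it lies in `sepArms κ n N`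
  (`16 ≤ n ≤ N`; `cone_mem_sepOpenArmIn` in every frame);
* `determinedBy_sepArms`, `triSitePercolation_sepArms_pos` — locality in `Λ_{N + N/8}` and positivity
  (cylinder events have positive probability, `triSitePercolation_half_cylinder_pos`).

Everything here is PROVED; no named fact is introduced.

## References

* P. Nolin, *Near-critical percolation in two dimensions*, Electron. J. Probab. 13 (2008), §4.2–4.3,
  Thm. 11 [arXiv 0711.4948: Def. 6–8, Thm. 10]. [Nolin2008]

Tree: `sepArms`, `sepArms_eq_inter`, `determinedBy_sepArmsCol` (`SepArmsGlue.lean`); `triCone`,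
`readFrame`, `mem_readFrame`, `mem_sepArmAt`, `isUpperSet_sepOpenArmIn` (`ArmSeparationFourArm.lean`);
`cone_mem_sepOpenArmIn`, `image_rot_sepConeSupport_subset_ball` (`ArmSeparationFourArmProofs.lean`);
`rot_sector_injective` (`ArmEventsAPrioriPoly.lean`); `TwoArmPos.triSitePercolation_half_cylinder_pos`
(`ArmEventsProofs.lean`).
-/

noncomputable section

open MeasureTheory Set

namespace Literature.Probability.Percolation

open LatticeModels

variable {k : ℕ}

/-! ### Non-vacuity of `sepArms κ`: the configuration open exactly on the cones of the open sides -/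

/-- **The cone configuration of colours `κ`**: open exactly on the open cones `ρ^j(triCone)` over the
sides `j` with `κ j = true` (`k ≤ 6`). [folklore] -/
def coneConfig (κ : Fin k → Bool) : SiteConfig (Site 2) :=
  {v | ∃ j : Fin k, κ j = true ∧ (triRotIsoPow j.val).symm v ∈ triCone}

/-- Read in the frame and colour of ANY arm, the cone configuration contains the open cone over
side `0`: for an open side `j` the cone `ρ^j(triCone)` is open; for a closed side `j` it is closed,
the open cones being those of other sides (`rot_sector_injective`). [folklore] -/
theorem triCone_le_readFrame_coneConfig (hk : k ≤ 6) (κ : Fin k → Bool) (j : Fin k) :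
    (triCone : Set (Site 2)) ≤ readFrame j.val (κ j) (coneConfig κ) := by
  intro v hv
  rw [mem_readFrame]
  cases hj : κ j
  · simp only [Bool.false_eq_true, iff_false, coneConfig, mem_setOf_eq, not_exists, not_and]
    intro i hi hci
    have e : triRotIsoPow i.val ((triRotIsoPow i.val).symm (triRotIsoPow j.val v)) = triRotIsoPow j.val v :=
      RelIso.apply_symm_apply _ _
    have hij : i.val = j.val := rot_sector_injective (lt_of_lt_of_le i.2 hk) (lt_of_lt_of_le j.2 hk) hci hv e
    have : κ i = κ j := by rw [Fin.ext hij]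
    rw [hi, hj] at this
    exact Bool.noConfusion this
  · simp only [iff_true, coneConfig, mem_setOf_eq]
    exact ⟨j, hj, by rw [RelIso.symm_apply_apply]; exact hv⟩

/-- **The cone configuration lies in `sepArms κ n N`** for `k ≤ 6`, `16 ≤ n ≤ N`: each arm `j` is
carried by the cone `ρ^j(triCone)` (carriers pairwise disjoint), in whose frame and colour the
configuration contains the open cone, which realises the fenced open arm
(`cone_mem_sepOpenArmIn`, monotonicity of `sepOpenArmIn`). [cite: Nolin2008, Thm. 11 (arXiv 0711.4948: Thm. 10)] -/
theorem coneConfig_mem_sepArms (hk : k ≤ 6) (κ : Fin k → Bool) {n N : ℕ} (hn : 16 ≤ n) (hnN : n ≤ N) :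
    coneConfig κ ∈ sepArms κ n N := by
  have K := cone_mem_sepOpenArmIn hn hnN
  refine ⟨fun j => {w | (triRotIsoPow j.val).symm w ∈ triCone}, fun i j hij _ => ?_, fun j => ?_⟩
  · rw [Set.disjoint_left]
    intro w hi hj'
    rw [mem_setOf_eq] at hi hj'
    have e : triRotIsoPow i.val ((triRotIsoPow i.val).symm w) = triRotIsoPow j.val ((triRotIsoPow j.val).symm w) := by
      rw [RelIso.apply_symm_apply, RelIso.apply_symm_apply]
    exact hij (Fin.ext (rot_sector_injective (lt_of_lt_of_le i.2 hk) (lt_of_lt_of_le j.2 hk) hi hj' e))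
  · rw [mem_sepArmAt]
    have e : (triRotIsoPow j.val) ⁻¹' {w : Site 2 | (triRotIsoPow j.val).symm w ∈ triCone} = triCone := by
      ext v; rw [mem_preimage, mem_setOf_eq, RelIso.symm_apply_apply]
    rw [e]
    exact isUpperSet_sepOpenArmIn _ n N (triCone_le_readFrame_coneConfig hk κ j) K

/-- `sepArms κ n N` is determined by the sites of `Λ_{N + N/8}` (`4 ≤ n ≤ N`). [folklore] -/
theorem determinedBy_sepArms (κ : Fin k → Bool) {n N : ℕ} (h4 : 4 ≤ n) (hnN : n ≤ N) :
    DeterminedBy (sepArms κ n N) ↑(triBall (N + N / 8)) := by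
  rw [sepArms_eq_inter]
  exact (determinedBy_sepArmsCol κ true h4 hnN fun j _ => image_rot_sepConeSupport_subset_ball j.val n N).inter
    (determinedBy_sepArmsCol κ false h4 hnN fun j _ => image_rot_sepConeSupport_subset_ball j.val n N)

/-- **The well-separated `k`-arm event has positive probability** (`k ≤ 6`, `16 ≤ n ≤ N`): it is
determined by the sites of `Λ_{N + N/8}` and contains the cone configuration, hence the cylinder
event of the configurations agreeing with it there. This is the necessary condition
`P_{1/2}(sepArms κ n N) > 0` for the separation hypothesis
`c · π_κ(n, N) ≤ P_{1/2}(sepArms κ n N)` of `polyArmProb_quasiMult_of_sepArms_separation` whenever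
`π_κ(n, N) > 0` — a consistency check of the Lean rendering, not a proof of it. [cite: Nolin2008, Thm. 11 (arXiv 0711.4948: Thm. 10)] -/
theorem triSitePercolation_sepArms_pos (hk : k ≤ 6) (κ : Fin k → Bool) {n N : ℕ} (hn : 16 ≤ n) (hnN : n ≤ N) :
    0 < (triSitePercolation half).real (sepArms κ n N) := by
  classical
  have h4 : 4 ≤ n := le_trans (by norm_num) hn
  have dS := determinedBy_sepArms κ h4 hnN
  have hcyl : {ω : Set (Site 2) | ∀ v ∈ triBall (N + N / 8), (v ∈ ω ↔ v ∈ coneConfig κ)} ⊆ sepArms κ n N := by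
    intro ω hω
    have heq : ω ∩ ↑(triBall (N + N / 8)) = coneConfig κ ∩ ↑(triBall (N + N / 8)) := by
      ext v
      simp only [mem_inter_iff, Finset.mem_coe]
      constructor
      · rintro ⟨h1, h2⟩; exact ⟨(hω v h2).1 h1, h2⟩
      · rintro ⟨h1, h2⟩; exact ⟨(hω v h2).2 h1, h2⟩
    exact ((determinedBy_iff _ _).1 dS ω (coneConfig κ) heq).2 (coneConfig_mem_sepArms hk κ hn hnN)
  exact (TwoArmPos.triSitePercolation_half_cylinder_pos (triBall (N + N / 8))
    (fun v => v ∈ coneConfig κ)).trans_le (measureReal_mono hcyl (measure_ne_top _ _))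

end Literature.Probability.Percolation

end
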